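import Literature.Probability.LatticeModels.GridDomainHittingProbabilityProofs
import Literature.Probability.LatticeModels.GridDomainConformalSteps
import Literature.Probability.LatticeModels.WeakBeurlingEstimate
import Literature.Analysis.Complex.FarSetConformalDiameter
import HarnessLib

/-!
# Conformal geometry of grid domains of the class `𝔇` with large inner radius: lattice steps and
# darts are conformally short, the disc map is proper, conformal-interior points, lattice edges

Topic `Literature/Probability/LatticeModels`; continuation of `GridDomainHittingProbabilityProofs.lean`
(groundwork for G. F. Lawler, O. Schramm, W. Werner, *Conformal invariance of planar loop-erased
random walks and uniform spanning trees*, Ann. Probab. 32 (2004), Prop. 2.2). The proof of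
Prop. 2.2 (§5.2) uses throughout, for `D ∈ 𝔇` with `inrad(D)` large and its disc map `ψ = ψ_D`,
that lattice steps are uniformly small in conformal coordinates ("assume that `inrad(D)` is
sufficiently large so that any nearest neighbor path from `0` to `u` in `D` has a vertex in `W`";
"`inrad(D)` large enough to guarantee that `W` separates `V(δ, ε₁)` from `u`"), that the boundary
value `ψ(u)` of a dart `u = (v, [q,v])` is the limit along the edge, and that near a conformal
interior point there are lattice points ("the Koebe distortion theorem … we may find a vertex `v`
with `|ψ(v) - z| < c₂/4`, assuming that `r₀` is large enough"). This file proves these facts in the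
vocabulary of `GridDomainHittingProbability.lean`, all from the tree's function theory:

* `LSWGrid.norm_sub_le_of_isPreconnected` and its threshold form `LSWGrid.meshBound_le` — every
  preconnected `Q ⊆ D` of diameter `< 1` has `‖ψ z₁ - ψ z₂‖ ≤ 1500/√(log(inrad/3))` on `Q`
  (the tree's `FarSet.norm_sub_le_of_inradius`, Wolff's length–area lemma + Schwarz–Pick); hence
  **lattice steps** (`LSWGrid.norm_sub_le_meshBound_of_adj`), **dart edges**
  (`LSWGrid.norm_sub_le_meshBound_of_dart`) and the **boundary value of a dart**
  (`LSWGrid.norm_boundaryValue_sub_le`) are within `1500/√(log(inrad/3))` in conformal coordinates;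
* `LSWGrid.eventually_lt_norm`, `LSWGrid.tendsto_norm_nhdsWithin`, `LSWGrid.tendsto_norm_dart` —
  **the disc map is proper**: `‖ψ z‖ → 1` as `z → b ∉ D` inside `D`, in particular along a dart;
* `LSWGrid.ball_subset_of_norm_le`, `LSWGrid.one_sub_lt_norm_of_infDist_lt` — **Koebe**: a point
  with `‖ψ z‖ ≤ 1 - s` carries the disc `B(z, inrad·s²/32) ⊆ D`; points Euclidean-close to the
  complement are conformally close to the circle;
* `LSWGrid.exists_site_norm_sub_lt` — **lattice points near conformal-interior points** (Koebe);
* `LSWGrid.finite_latticeVertices_norm_le` — finitely many lattice points of `D` have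
  `‖ψ‖ ≤ r < 1`;
* `LSWGrid.exists_common_endpoint` — **two closed lattice edges that meet share an endpoint**
  (a point of an edge is at distance `≥ 1` from every lattice point other than the edge's ends,
  `one_le_dist_of_mem_segment`).

Everything is proved; no definition and no named fact is introduced.

## References

* G. F. Lawler, O. Schramm, W. Werner, Ann. Probab. 32 (2004) 939–995, §2.2, §5.2 [LawlerSchrammWerner2004].
* Ch. Pommerenke, *Boundary Behaviour of Conformal Maps* (1992), Prop. 2.2, Cor. 2.3; Thm. 1.3,
  Cor. 1.4 [PommerenkeBBCM1992].
-/

noncomputable section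

open Set Metric Filter
open scoped Topology

namespace Literature.Probability.LatticeModels

namespace LSWGrid

open Complex Literature.Analysis.Complex
open WeakBeurling (sqBox mem_sqBox sqBox_finite)

variable {D : Set ℂ} {ψ : ℂ → ℂ}

/-! ### Conformal smallness of sets of diameter `< 1` (length–area) -/

/-- **Sets of diameter `< 1` are conformally small when the inner radius is large**: for `D ∈ 𝔇`
with `inrad(D) ≥ 8`, a disc map `ψ`, and a preconnected `Q ⊆ D` inside a unit disc,
`‖ψ z₁ - ψ z₂‖ ≤ 1500/√(log(inrad(D)/3))` for `z₁, z₂ ∈ Q` (the tree's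
`FarSet.norm_sub_le_of_inradius` for `g = ψ`, `f = ψ⁻¹`). [cite: PommerenkeBBCM1992, Prop. 2.2] -/
theorem norm_sub_le_of_isPreconnected (hD : IsClassD D) (hψ : IsDiscMap D ψ)
    (hR : 8 ≤ infDist (0 : ℂ) Dᶜ) {Q : Set ℂ} (hQ : IsPreconnected Q) (hQD : Q ⊆ D)
    {p : ℂ} (hQp : Q ⊆ ball p 1) {z₁ z₂ : ℂ} (hz₁ : z₁ ∈ Q) (hz₂ : z₂ ∈ Q) :
    ‖ψ z₁ - ψ z₂‖ ≤ 1500 / Real.sqrt (Real.log (infDist (0 : ℂ) Dᶜ / 3)) := by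
  have hopen : IsOpen D := hD.1.1
  have hball : ball (Function.invFunOn ψ D 0) (infDist (0 : ℂ) Dᶜ) ⊆ D := by
    rw [hψ.inv_zero hD.2.2.1]
    exact Metric.ball_infDist_compl_subset
  exact FarSet.norm_sub_le_of_inradius hopen hψ.1 hψ.2.1.mapsTo (hψ.differentiableOn_inv hopen)
    hψ.mapsTo_inv (fun w hw => hψ.rightInvOn hw) (fun z hz => hψ.leftInvOn hz) hR hball hQ hQD hQp
    hz₁ hz₂

/-- **The threshold**: `1500/√(log(R/3)) ≤ μ` as soon as `R ≥ 3 exp((1500/μ)²)`. [folklore] -/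
theorem meshBound_le {μ : ℝ} (hμ : 0 < μ) {R : ℝ} (hR : 3 * Real.exp ((1500 / μ) ^ 2) ≤ R) :
    1500 / Real.sqrt (Real.log (R / 3)) ≤ μ := by
  have hexp : 0 < Real.exp ((1500 / μ) ^ 2) := Real.exp_pos _
  have hR3 : Real.exp ((1500 / μ) ^ 2) ≤ R / 3 := by linarith
  have hlog : (1500 / μ) ^ 2 ≤ Real.log (R / 3) := by
    rw [Real.le_log_iff_exp_le (hexp.trans_le hR3)]
    exact hR3
  have hsq : 1500 / μ ≤ Real.sqrt (Real.log (R / 3)) :=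
    Real.le_sqrt_of_sq_le hlog
  have hpos : 0 < 1500 / μ := by positivity
  calc 1500 / Real.sqrt (Real.log (R / 3)) ≤ 1500 / (1500 / μ) :=
        div_le_div_of_nonneg_left (by norm_num) hpos hsq
    _ = μ := by field_simp

/-- **Lattice steps are conformally short**: for adjacent lattice points `x, y` of `D ∈ 𝔇`
(`inrad(D) ≥ 8`), `‖ψ(x) - ψ(y)‖ ≤ 1500/√(log(inrad(D)/3))` (the closed edge `[x, y]` lies in
`D`). [cite: LawlerSchrammWerner2004, §5.2] -/
theorem norm_sub_le_meshBound_of_adj (hD : IsClassD D) (hψ : IsDiscMap D ψ)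
    (hR : 8 ≤ infDist (0 : ℂ) Dᶜ) {x y : Site 2} (hx : x ∈ latticeVertices D)
    (hy : y ∈ latticeVertices D) (hxy : (zdGraph 2).Adj x y) :
    ‖ψ (Site.toComplex x) - ψ (Site.toComplex y)‖ ≤
      1500 / Real.sqrt (Real.log (infDist (0 : ℂ) Dᶜ / 3)) := by
  set X := Site.toComplex x with hX
  set Y := Site.toComplex y with hY
  set p : ℂ := X + (1 / 2 : ℝ) • (Y - X) with hp
  have hXY : ‖Y - X‖ = 1 := norm_toComplex_sub_of_adj hxy
  have hQp : segment ℝ X Y ⊆ ball p 1 := by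
    rw [segment_eq_image']
    rintro _ ⟨t, ⟨ht0, ht1⟩, rfl⟩
    rw [mem_ball, dist_eq_norm]
    have : X + t • (Y - X) - p = (t - 1 / 2 : ℝ) • (Y - X) := by
      rw [hp, sub_smul]; abel
    rw [this, norm_smul, hXY, mul_one, Real.norm_eq_abs]
    rw [abs_lt]; constructor <;> linarith
  exact norm_sub_le_of_isPreconnected hD hψ hR (convex_segment X Y).isPreconnected
    (segment_subset hD.1 hx hy hxy) hQp (left_mem_segment ℝ X Y) (right_mem_segment ℝ X Y)

/-- **Dart edges are conformally short**: for `q ∈ V(D)` and a lattice neighbour `v`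
(`D ∈ 𝔇`, `inrad(D) ≥ 8`), every point of the half-open edge `[q, v)` has `ψ`-image within
`1500/√(log(inrad(D)/3))` of `ψ(q)`. [cite: LawlerSchrammWerner2004, §2.2] -/
theorem norm_sub_le_meshBound_of_dart (hD : IsClassD D) (hψ : IsDiscMap D ψ)
    (hR : 8 ≤ infDist (0 : ℂ) Dᶜ) {q v : Site 2} (hq : q ∈ latticeVertices D)
    (hqv : (zdGraph 2).Adj q v) {t : ℝ} (ht0 : 0 ≤ t) (ht1 : t < 1) :
    ‖ψ (Site.toComplex q + (t : ℂ) * (Site.toComplex v - Site.toComplex q)) - ψ (Site.toComplex q)‖ ≤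
      1500 / Real.sqrt (Real.log (infDist (0 : ℂ) Dᶜ / 3)) := by
  set X := Site.toComplex q with hX
  set Y := Site.toComplex v with hY
  set γ : ℝ → ℂ := fun s => X + (s : ℂ) * (Y - X) with hγ
  set Q : Set ℂ := γ '' Ico 0 1 with hQ
  set p : ℂ := X + (1 / 2 : ℝ) • (Y - X) with hp
  have hXY : ‖Y - X‖ = 1 := norm_toComplex_sub_of_adj hqv
  have hγc : Continuous γ := by rw [hγ]; fun_prop
  have hQc : IsPreconnected Q := isPreconnected_Ico.image γ hγc.continuousOn
  have hQD : Q ⊆ D := by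
    rintro _ ⟨s, ⟨hs0, hs1⟩, rfl⟩
    exact mem_of_mem_Ico hD.1 hq hqv hs0 hs1
  have hQp : Q ⊆ ball p 1 := by
    rintro _ ⟨s, ⟨hs0, hs1⟩, rfl⟩
    rw [mem_ball, dist_eq_norm]
    have : γ s - p = ((s - 1 / 2 : ℝ) : ℂ) * (Y - X) := by
      simp only [hγ, hp, Complex.real_smul]; push_cast; ring
    rw [this, norm_mul, Complex.norm_real, hXY, mul_one, Real.norm_eq_abs, abs_lt]
    constructor <;> linarith
  have h0 : γ 0 = X := by simp [hγ]
  have key := norm_sub_le_of_isPreconnected hD hψ hR hQc hQD hQp ⟨t, ⟨ht0, ht1⟩, rfl⟩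
    ⟨0, ⟨le_rfl, zero_lt_one⟩, rfl⟩
  rwa [h0] at key

/-- **The boundary value of a dart is conformally close to its base**: if `ψ` tends to `c` along
the edge `[q, v)` from `q ∈ V(D)`, then `‖c - ψ(q)‖ ≤ 1500/√(log(inrad(D)/3))`.
[cite: LawlerSchrammWerner2004, §2.2] -/
theorem norm_boundaryValue_sub_le (hD : IsClassD D) (hψ : IsDiscMap D ψ)
    (hR : 8 ≤ infDist (0 : ℂ) Dᶜ) {q v : Site 2} (hq : q ∈ latticeVertices D)
    (hqv : (zdGraph 2).Adj q v) {c : ℂ}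
    (hc : Tendsto (fun t : ℝ => ψ (Site.toComplex q + (t : ℂ) * (Site.toComplex v - Site.toComplex q)))
      (𝓝[<] (1 : ℝ)) (𝓝 c)) :
    ‖c - ψ (Site.toComplex q)‖ ≤ 1500 / Real.sqrt (Real.log (infDist (0 : ℂ) Dᶜ / 3)) := by
  have hT : Tendsto (fun t : ℝ => ‖ψ (Site.toComplex q + (t : ℂ) * (Site.toComplex v - Site.toComplex q)) -
      ψ (Site.toComplex q)‖) (𝓝[<] (1 : ℝ)) (𝓝 ‖c - ψ (Site.toComplex q)‖) :=
    (hc.sub tendsto_const_nhds).norm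
  refine le_of_tendsto hT ?_
  filter_upwards [Ico_mem_nhdsLT zero_lt_one] with t ht
  exact norm_sub_le_meshBound_of_dart hD hψ hR hq hqv ht.1 ht.2

/-! ### The disc map is proper -/

/-- **Near a point outside `D`, the disc map is conformally near the circle**: for `b ∉ D` and
`r < 1`, eventually along `𝓝[D] b` one has `‖ψ z‖ > r` (the compact set `ψ⁻¹(B̄(0, r)) ⊆ D`
misses a neighbourhood of `b`). [folklore] -/
theorem eventually_lt_norm (hD : IsClassD D) (hψ : IsDiscMap D ψ) {b : ℂ} (hb : b ∉ D) {r : ℝ}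
    (hr : r < 1) : ∀ᶠ z in 𝓝[D] b, r < ‖ψ z‖ := by
  have hopen : IsOpen D := hD.1.1
  set F := Function.invFunOn ψ D with hF
  have hFc : ContinuousOn F (closedBall 0 r) :=
    (hψ.differentiableOn_inv hopen).continuousOn.mono (closedBall_subset_ball hr)
  set K : Set ℂ := F '' closedBall 0 r with hK
  have hKc : IsCompact K := (isCompact_closedBall 0 r).image_of_continuousOn hFc
  have hKD : K ⊆ D := by
    rintro _ ⟨ζ, hζ, rfl⟩
    exact hψ.mapsTo_inv (closedBall_subset_ball hr hζ)
  have hbK : b ∉ K := fun h => hb (hKD h)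
  have hnhds : Kᶜ ∈ 𝓝 b := hKc.isClosed.isOpen_compl.mem_nhds hbK
  rw [eventually_nhdsWithin_iff]
  filter_upwards [hnhds] with z hzK hzD
  by_contra hle
  push Not at hle
  have hψz : ψ z ∈ closedBall (0 : ℂ) r := mem_closedBall_zero_iff.2 hle
  have : z ∈ K := ⟨ψ z, hψz, hψ.leftInvOn hzD⟩
  exact hzK this

/-- **The disc map is proper**: `‖ψ z‖ → 1` as `z → b ∉ D` inside `D`. [folklore] -/
theorem tendsto_norm_nhdsWithin (hD : IsClassD D) (hψ : IsDiscMap D ψ) {b : ℂ} (hb : b ∉ D) :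
    Tendsto (fun z => ‖ψ z‖) (𝓝[D] b) (𝓝 1) := by
  refine tendsto_order.2 ⟨fun r hr => eventually_lt_norm hD hψ hb hr, fun r hr => ?_⟩
  filter_upwards [self_mem_nhdsWithin] with z hz
  exact (hψ.norm_lt_one hz).trans hr

/-- **Along a dart the disc map tends to the circle**: for `q ∈ V(D)` and a lattice neighbour
`v ∉ V(D)`, `‖ψ(q + t(v - q))‖ → 1` as `t → 1⁻`. [cite: LawlerSchrammWerner2004, §2.2] -/
theorem tendsto_norm_dart (hD : IsClassD D) (hψ : IsDiscMap D ψ) {q v : Site 2}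
    (hq : q ∈ latticeVertices D) (hv : v ∉ latticeVertices D) (hqv : (zdGraph 2).Adj q v) :
    Tendsto (fun t : ℝ => ‖ψ (Site.toComplex q + (t : ℂ) * (Site.toComplex v - Site.toComplex q))‖)
      (𝓝[<] (1 : ℝ)) (𝓝 1) := by
  have hγ : Tendsto (fun t : ℝ => Site.toComplex q + (t : ℂ) * (Site.toComplex v - Site.toComplex q))
      (𝓝[<] (1 : ℝ)) (𝓝[D] (Site.toComplex v)) :=
    tendsto_nhdsWithin_iff.2 ⟨tendsto_edge_nhdsLT q v, eventually_mem_nhdsLT hD.1 hq hqv⟩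
  exact (tendsto_norm_nhdsWithin hD hψ hv).comp hγ

/-! ### Conformal-interior points (Koebe) -/

/-- **A conformal-interior point carries a large disc**: if `z ∈ D` has `‖ψ z‖ ≤ 1 - s`, `s > 0`,
then `B(z, inrad(D) s²/32) ⊆ D` (Koebe's one-quarter theorem and the distortion theorem for
`ψ⁻¹`, the tree's `KoebeInterior.ball_subset_image_of_norm_le`). [cite: PommerenkeBBCM1992, Cor. 1.4] -/
theorem ball_subset_of_norm_le (hD : IsClassD D) (hψ : IsDiscMap D ψ) {z : ℂ} (hz : z ∈ D)
    {s : ℝ} (hs0 : 0 < s) (hzs : ‖ψ z‖ ≤ 1 - s) :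
    ball z (infDist (0 : ℂ) Dᶜ * s ^ 2 / 32) ⊆ D := by
  have hopen : IsOpen D := hD.1.1
  set F := Function.invFunOn ψ D with hF
  have hsub : ball (F 0) (infDist (0 : ℂ) Dᶜ) ⊆ F '' ball 0 1 := by
    rw [hF, hψ.inv_zero hD.2.2.1, hψ.image_inv]
    exact Metric.ball_infDist_compl_subset
  have h := KoebeInterior.ball_subset_image_of_norm_le (hψ.differentiableOn_inv hopen) hψ.injOn_inv
    (inrad_pos hD) hsub hzs (by linarith : 1 - s < 1)
  rw [hψ.leftInvOn hz, hψ.image_inv, show 1 - (1 - s) = s by ring] at h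
  exact h

/-- **Points Euclidean-close to the complement are conformally close to the circle**: if
`dist(z, Dᶜ) < inrad(D) s²/32` then `‖ψ z‖ > 1 - s`. [cite: PommerenkeBBCM1992, Cor. 1.4] -/
theorem one_sub_lt_norm_of_infDist_lt (hD : IsClassD D) (hψ : IsDiscMap D ψ) {z : ℂ} (hz : z ∈ D)
    {s : ℝ} (hs0 : 0 < s) (hd : infDist z Dᶜ < infDist (0 : ℂ) Dᶜ * s ^ 2 / 32) :
    1 - s < ‖ψ z‖ := by
  by_contra hle
  push Not at hle
  have hne : (Dᶜ).Nonempty := nonempty_compl.2 hD.2.2.2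
  obtain ⟨y, hy, hdy⟩ := (infDist_lt_iff hne).1 hd
  exact hy (ball_subset_of_norm_le hD hψ hz hs0 hle (mem_ball'.2 hdy))

/-- **Lattice points near conformal-interior points** ("we may find a vertex `v ∈ V(D')` such that
`|ψ_{D'}(v) - z| < c₂/4`, assuming that `r₀` is large enough"): if `‖ζ₀‖ ≤ r < 1`,
`0 < τ ≤ 1 - r` and `τ · inrad(D) · (1 - r) > 32`, some lattice point `x ∈ V(D)` has
`‖ψ(x) - ζ₀‖ < τ` (the lattice point nearest to `ψ⁻¹(ζ₀)`, by the tree's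
`KoebeInterior.exists_apply_eq_of_norm_sub_lt`). [cite: LawlerSchrammWerner2004, §5.2] -/
theorem exists_site_norm_sub_lt (hD : IsClassD D) (hψ : IsDiscMap D ψ) {ζ₀ : ℂ} {r : ℝ}
    (hζ₀ : ‖ζ₀‖ ≤ r) (hr : r < 1) {τ : ℝ} (hτ : 0 < τ) (hτ1 : τ ≤ 1 - r)
    (hbig : 32 < τ * infDist (0 : ℂ) Dᶜ * (1 - r)) :
    ∃ x : Site 2, x ∈ latticeVertices D ∧ ‖ψ (Site.toComplex x) - ζ₀‖ < τ := by
  have hopen : IsOpen D := hD.1.1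
  set F := Function.invFunOn ψ D with hF
  have hsub : ball (F 0) (infDist (0 : ℂ) Dᶜ) ⊆ F '' ball 0 1 := by
    rw [hF, hψ.inv_zero hD.2.2.1, hψ.image_inv]
    exact Metric.ball_infDist_compl_subset
  set x : Site 2 := nearestSite 1 (F ζ₀) with hx
  have hv : ‖Site.toComplex x - F ζ₀‖ < τ * infDist (0 : ℂ) Dᶜ * (1 - r) / 32 := by
    have h1 : ‖Site.toComplex x - F ζ₀‖ ≤ 1 := by
      have h := dist_meshPoint_nearestSite_le one_pos (F ζ₀)
      rwa [meshPoint_one, dist_eq_norm] at h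
    have h2 : (1 : ℝ) < τ * infDist (0 : ℂ) Dᶜ * (1 - r) / 32 := by
      rw [lt_div_iff₀ (by norm_num : (0 : ℝ) < 32)]; linarith
    exact h1.trans_lt h2
  obtain ⟨ζ', hζ'ζ, hζ'1, hFζ'⟩ := KoebeInterior.exists_apply_eq_of_norm_sub_lt
    (hψ.differentiableOn_inv hopen) hψ.injOn_inv (inrad_pos hD) hsub hζ₀ hr hτ hτ1 hv
  have hζ'b : ζ' ∈ ball (0 : ℂ) 1 := mem_ball_zero_iff.2 hζ'1
  refine ⟨x, ?_, ?_⟩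
  · show Site.toComplex x ∈ D
    rw [← hFζ']
    exact hψ.mapsTo_inv hζ'b
  · rw [← hFζ', hψ.rightInvOn hζ'b]
    exact hζ'ζ

/-- **Finitely many lattice points of `D` are conformally interior**: for `r < 1` the set of
`x ∈ V(D)` with `‖ψ(x)‖ ≤ r` is finite (it lies in the compact set `ψ⁻¹(B̄(0, r))`). [folklore] -/
theorem finite_latticeVertices_norm_le (hD : IsClassD D) (hψ : IsDiscMap D ψ) {r : ℝ} (hr : r < 1) :
    {x : Site 2 | x ∈ latticeVertices D ∧ ‖ψ (Site.toComplex x)‖ ≤ r}.Finite := by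
  have hopen : IsOpen D := hD.1.1
  set F := Function.invFunOn ψ D with hF
  have hFc : ContinuousOn F (closedBall 0 r) :=
    (hψ.differentiableOn_inv hopen).continuousOn.mono (closedBall_subset_ball hr)
  have hKc : IsCompact (F '' closedBall 0 r) := (isCompact_closedBall 0 r).image_of_continuousOn hFc
  obtain ⟨M, hM⟩ := hKc.isBounded.exists_norm_le
  set N : ℕ := ⌈M⌉₊ with hN
  refine ((sqBox_finite 0 N)).subset fun x hx => ?_
  obtain ⟨hxD, hxr⟩ := hx
  have hmem : Site.toComplex x ∈ F '' closedBall 0 r :=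
    ⟨ψ (Site.toComplex x), mem_closedBall_zero_iff.2 hxr, hψ.leftInvOn hxD⟩
  have hnorm : ‖Site.toComplex x‖ ≤ N := (hM _ hmem).trans (Nat.le_ceil M)
  have hre : |((x 0 : ℤ) : ℝ)| ≤ N := by
    have h := Complex.abs_re_le_norm (Site.toComplex x)
    have : (Site.toComplex x).re = (x 0 : ℝ) := by simp [Site.toComplex]
    rw [this] at h
    exact h.trans hnorm
  have him : |((x 1 : ℤ) : ℝ)| ≤ N := by
    have h := Complex.abs_im_le_norm (Site.toComplex x)
    have : (Site.toComplex x).im = (x 1 : ℝ) := by simp [Site.toComplex]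
    rw [this] at h
    exact h.trans hnorm
  rw [mem_sqBox]
  simp only [Pi.zero_apply, sub_zero]
  have hre' : ((|x 0| : ℤ) : ℝ) ≤ ((N : ℤ) : ℝ) := by rw [Int.cast_abs]; exact_mod_cast hre
  have him' : ((|x 1| : ℤ) : ℝ) ≤ ((N : ℤ) : ℝ) := by rw [Int.cast_abs]; exact_mod_cast him
  exact ⟨by exact_mod_cast hre', by exact_mod_cast him'⟩

/-! ### Two lattice edges that meet share an endpoint -/

/-- **Two closed lattice edges that meet share a lattice endpoint**: if `a ∼ b` and `c ∼ d` in `ℤ²`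
and the closed segments `[a, b]`, `[c, d]` have a common point, then `{a, b} ∩ {c, d} ≠ ∅` (a
point of `[a, b]` is at distance `≥ 1` from every lattice point other than `a, b`, while its
distances to `c` and `d` sum to `1`). [folklore] -/
theorem exists_common_endpoint {a b c d : Site 2} (hab : (zdGraph 2).Adj a b)
    (hcd : (zdGraph 2).Adj c d)
    (h : (segment ℝ (Site.toComplex a) (Site.toComplex b) ∩
      segment ℝ (Site.toComplex c) (Site.toComplex d)).Nonempty) :
    ∃ x : Site 2, (x = a ∨ x = b) ∧ (x = c ∨ x = d) := by
  by_contra hne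
  push Not at hne
  obtain ⟨p, hp1, hp2⟩ := h
  have hca : c ≠ a := fun h => (hne c (Or.inl h)).1 rfl
  have hcb : c ≠ b := fun h => (hne c (Or.inr h)).1 rfl
  have hda : d ≠ a := fun h => (hne d (Or.inl h)).2 rfl
  have hdb : d ≠ b := fun h => (hne d (Or.inr h)).2 rfl
  have h1 : 1 ≤ dist p (Site.toComplex c) := one_le_dist_of_mem_segment hab hca hcb hp1
  have h2 : 1 ≤ dist p (Site.toComplex d) := one_le_dist_of_mem_segment hab hda hdb hp1
  have h3 : dist (Site.toComplex c) p + dist p (Site.toComplex d) =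
      dist (Site.toComplex c) (Site.toComplex d) := dist_add_dist_of_mem_segment hp2
  have h4 : dist (Site.toComplex c) (Site.toComplex d) = 1 := by
    rw [dist_comm, dist_eq_norm]
    exact norm_toComplex_sub_of_adj hcd
  rw [dist_comm] at h1
  linarith

end LSWGrid

end Literature.Probability.LatticeModels

end
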